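import Literature.NumberTheory.QuadraticForms.PrescribedNormClassesCM
import Literature.NumberTheory.Automorphic.Liu2021.Def412AdmissibleIffParity
import Literature.NumberTheory.Automorphic.Liu2021.Def411WeilCarriers
import Literature.NumberTheory.GelbartRogawski1991.UnitaryDualPairThetaKernelCM
import HarnessLib

/-!
# FLOOR-0 P2 — stub GL `stub_GL_globalLine` of the sub-line `Cruxes/H413/Lines/F0_P2CELocalToGlobal.lean` (F0P2-plan (g4); crux item
# stmt-HodgeConjecture-24833 `HCCMUnconditional.H413`, socket item F0HdictE = stmt-HodgeConjecture-27455): COFINITE FAMILIES OF LOCAL NORM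
# CLASSES ARE GLOBAL

Cell hodgecm-mathlib (D-0151), FLOOR 0, programme P2; seat F0P2-p03 (g3) (F0P2-plan (g4) ruling 2026-08-31T02:42:11Z (d): «p03 ← GL + LW»).
THEOREMS ONLY (no `def`, no instance, no notation, no named fact, no `sorry`); never imports a `Cruxes/…/Lines` module (s347 ∕ s380b): the
registered body of `F0P2CELocalToGlobal.StubGLGlobalLine` (sub-line v1, HOME mirror `F0/P2/F0_P2CELocalToGlobal.v1.F0P2-plan-g4.lean` 4e2632f0 :207)
is RESTATED VERBATIM as the type of `stubGL_holds`.

STATEMENT.  `L` a CM field, `L⁺ = maximalRealSubfield L`, `d = imagUnitSq L = δ²` (`δ = imagUnit L`, `δ̄ = −δ ≠ 0`); for a family of lines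
`ε_v ∈ (L⁺)ˣ` (one per finite place `v` of `L⁺`) whose local norm classes `locF L⁺ d (ε_v) v ∈ L⁺_vˣ ⧸ N(L_vˣ)` ([Liu2021, Def. 4.11–4.12] carrier
★ `Def411WeilCarriers.locF`) agree with those of ONE `a₀` at almost every `v`, there is `a ∈ (L⁺)ˣ` with `locF a v = locF (ε_v) v` at EVERY `v`.

PROOF (the planner's road, ★ = in the tree).  `ε′_v := [ε_v]·[a₀]⁻¹` is a finitely supported family of local norm classes; `d` is negative at
every real place of the totally real `L⁺` (★ `Liu2021.embedding_of_isReal_lt_zero_of_coe_eq_mul_self`) and non-zero (★ `Liu2021.ne_zero_of_coe_eq_mul_self`);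
★ `QuadraticForms.exists_prescribed_normClass_of_finite` (O'Meara 71:19 ∕ 71:19a with the real signs as the parity valve, `w₀` = any infinite place,
real by `IsTotallyReal.isReal`) gives `θ ∈ (L⁺)ˣ` with local classes `ε′`; `a := θ·a₀` (`locF` is a group homomorphism).  ARCHIMEDEAN CLASSES FREE.
`--supports stmt-HodgeConjecture-24833 --as helper`.  HC_CM is proved only modulo the printed citations until rung 0 closes; this file discharges none.

## References
* [Omeara1963] O. T. O'Meara, *Introduction to Quadratic Forms* (1963): §65 Prop. 65:21, §71 Thm. 71:19, Cor. 71:19a.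
* [Liu2021] Y. Liu, Camb. J. Math. 9 (2021) = arXiv:2102.11518: Def. 4.11 (l. 2088), Def. 4.12 (l. 2105), Rem. 4.14.
-/

set_option autoImplicit false
-- the mandated namespace has the single-problem summit's repeated segment (`HodgeConjecture.HodgeConjecture`)
set_option linter.dupNamespace false

noncomputable section

open NumberField IsDedekindDomain

namespace Summit.HodgeConjecture.HodgeConjecture.Cruxes.H413.F0P2eStubGLGlobalLine

open Literature.NumberTheory Literature.NumberTheory.Automorphic
open Literature.NumberTheory.Automorphic.Liu2021 Literature.NumberTheory.Automorphic.Liu2021.Def411WeilCarriers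
open Literature.NumberTheory.GelbartRogawski1991 Literature.NumberTheory.GelbartRogawski1991.UnitaryDualPair
open Literature.NumberTheory.QuadraticForms

/-- **stub GL — cofinite families of local norm classes are GLOBAL** (registered body of `F0P2CELocalToGlobal.StubGLGlobalLine` verbatim).
Proof: prescribe the finitely supported family `[ε_v]·[a₀]⁻¹` by ★ `exists_prescribed_normClass_of_finite` (`d = imagUnitSq L` totally negative,
the real signs of `θ` free) and put `a := θ·a₀`. [cite: Omeara1963, §65 Prop. 65:21, §71 Thm. 71:19, Cor. 71:19a] [cite: Liu2021, Def 4.12 (l. 2105), Rem 4.14] -/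
theorem stubGL_holds :
    ∀ (L : Type) [Field L] [NumberField L] [IsCMField L]
      (ε : HeightOneSpectrum (𝓞 ↥(maximalRealSubfield L)) → (↥(maximalRealSubfield L))ˣ) (a₀ : (↥(maximalRealSubfield L))ˣ),
      (∀ᶠ v in Filter.cofinite, locF (↥(maximalRealSubfield L)) (imagUnitSq L) (ε v) v = locF (↥(maximalRealSubfield L)) (imagUnitSq L) a₀ v) →
        ∃ a : (↥(maximalRealSubfield L))ˣ, ∀ v : HeightOneSpectrum (𝓞 ↥(maximalRealSubfield L)), locF (↥(maximalRealSubfield L)) (imagUnitSq L) a v = locF (↥(maximalRealSubfield L)) (imagUnitSq L) (ε v) v := by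
  intro L _ _ _ ε a₀ hcof
  classical
  -- `d = δ²` is non-zero and negative at every (real) infinite place of the totally real `L⁺`
  have hd : ((imagUnitSq L : ↥(maximalRealSubfield L)) : L) = imagUnit L * imagUnit L := (imagUnit_mul_self L).symm
  have hd0 : (imagUnitSq L : ↥(maximalRealSubfield L)) ≠ 0 := ne_zero_of_coe_eq_mul_self (imagUnit_ne_zero L) hd
  have hd0' : ((imagUnitSq L : ↥(maximalRealSubfield L)) : ↥(maximalRealSubfield L)) ≠ 0 := hd0
  have hneg : ∀ (w : InfinitePlace ↥(maximalRealSubfield L)) (hw : w.IsReal),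
      InfinitePlace.embedding_of_isReal hw (imagUnitSq L) < 0 := fun w hw =>
    embedding_of_isReal_lt_zero_of_coe_eq_mul_self (complexConj_imagUnit L) (imagUnit_ne_zero L) hd w hw
  obtain ⟨w₀⟩ := (inferInstance : Nonempty (InfinitePlace ↥(maximalRealSubfield L)))
  have hw₀ : w₀.IsReal := IsTotallyReal.isReal w₀
  -- the finitely supported family of classes `ε′_v := [ε_v]·[a₀]⁻¹`
  let ε' : ∀ v : HeightOneSpectrum (𝓞 ↥(maximalRealSubfield L)),
      (v.adicCompletion ↥(maximalRealSubfield L))ˣ ⧸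
        quadraticNormSubgroup (v.adicCompletion ↥(maximalRealSubfield L))
          (algebraMap ↥(maximalRealSubfield L) (v.adicCompletion ↥(maximalRealSubfield L)) (imagUnitSq L)) :=
    fun v => locF ↥(maximalRealSubfield L) (imagUnitSq L) (ε v) v * (locF ↥(maximalRealSubfield L) (imagUnitSq L) a₀ v)⁻¹
  have hfin : {v | ε' v ≠ 1}.Finite := by
    refine (Filter.eventually_cofinite.1 hcof).subset fun v hv => ?_
    simp only [Set.mem_setOf_eq] at hv ⊢
    intro h
    exact hv (by simp only [ε', h, mul_inv_cancel])
  obtain ⟨θ, hθ⟩ := exists_prescribed_normClass_of_finite ↥(maximalRealSubfield L) (imagUnitSq L) hd0' hneg w₀ hw₀ ε' hfin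
  refine ⟨θ * a₀, fun v => ?_⟩
  have hθv : locF ↥(maximalRealSubfield L) (imagUnitSq L) θ v = ε' v := by
    rw [locF_apply]; exact hθ v
  rw [map_mul, Pi.mul_apply, hθv]
  simp only [ε', inv_mul_cancel_right]

end Summit.HodgeConjecture.HodgeConjecture.Cruxes.H413.F0P2eStubGLGlobalLine
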